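/-
Copyright (c) 2026 the pub-hodgecm-mathlib formalisation cell (harness21).  Prover seat hodgecm-mathlib-K2E1-p14 (g4), Track B ∕ K2-LIT, h413 = `stmt-HodgeConjecture-24833`,
R90-TF section S8 «ContSpec-n½», socket (E) `sock_S8_res_exhaustion_le_closure` of `Cruxes/H413/Lines/R90_S8_ResidualSpectrumU3B.lean` (B ED. 6 :254–:270): THE (E) ASSEMBLY
OF LETTERS (S8 dealer R90-CS-plan (g3) S8-R134 ∕ S8-R149 (2) «Q1∕Q2 = conclusion-shaped» ∕ S8-R151 (3); census of record `K2/K2E1-p14/g3/CENSUS-E-AssemblyLetters.K2E1-p14-g3.md`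
+ this seat's delta `K2/K2E1-p14/g4/CENSUS-E2-AssemblyLetters.K2E1-p14-g4.md`): the socket's conclusion bytes from ★ F1_qs at the K-type index of record, modulo FOUR NAMED
conclusion-shaped letters — (HEAD₃), (O₃) = R6₃ block orthogonality, (N₃) = no line mass outside the listed residues, (L₃) = the residue data — every other binder of ★ F1_qs DISCHARGED.
-/
import Summits.HodgeConjecture.HodgeConjecture.Theorems.R90S8KTypeProjectionGlueU3               -- ★ p862893: `hHead_kType_of_level_three`, `residualG_isotypic_density_kType_three_maximalLevel_assoc` ((D₃) ★ p862817); brings ★ F1_qs p862541, ★ K-type defs p862819, ★ G-DEFS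
import Summits.HodgeConjecture.HodgeConjecture.Theorems.R90S8ResGBlockArchStableU3                -- ★ p862921: `rightRegular_apply_mem_resGBlock` (the blocks are stable under height-preserving commuting translations)
import Summits.HodgeConjecture.HodgeConjecture.Theorems.R90S8PseudoEisensteinBlocksDenseU2          -- ★ (K2E1-p13): `le_topologicalClosure_sup_inf_orthogonal` (`K ≤ cl (A ⊔ (K ⊓ Aᗮ))`, `A ≤ K` closed)
import Summits.HodgeConjecture.HodgeConjecture.Theorems.R90S8ResGMidAtomU3Defs                     -- ★ p862682: `resGMidAtom`, `resGMidBlock`, `resGMidAtom_le_resGMidBlock`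
import Summits.HodgeConjecture.HodgeConjecture.Theorems.K2E1ChiEisensteinTopResidueCharLineU3       -- ★ F6: `mem_iSup_lineSubrep_cmDetChar_three_of_ae_eq` (a.e. `r·Θ((out x)⁻¹)` ⇒ in the character-line lattice)
import Summits.HodgeConjecture.HodgeConjecture.Theorems.K2E1MaximalLevelHeckePureTensorBridgeCMTwo  -- ★ `adelicVal_archToAdelic_inclusion_mem_standardMaximalCompactGL` (`ι_∞(K_∞) ⊆ K_∞·GL₃(𝒪̂)`, every `N`, `H`)
import Summits.HodgeConjecture.HodgeConjecture.Theorems.K2E1BorelEisensteinGodementU                -- ★ `borelHeight_mul_of_adelicVal_mem` (the maximal compact preserves the Borel height)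
import Literature.NumberTheory.Automorphic.UnitaryGroupAdelicProduct                             -- ★ `commute_archToAdelic_finAdelicToAdelic`
import HarnessLib

/-!
# S8 (E) — `R90S8ResExhaustionLeClosureOfLettersU3`: EXHAUSTION of `L²_res(U_{L/L⁺}(3))` by the character lines and the middle blocks, ASSEMBLED from ★ F1_qs at the K-type index of
# record, MODULO four named conclusion-shaped letters (HEAD₃) (O₃) (N₃) (L₃) — every structural binder of ★ F1_qs discharged in this file

Track B ∕ K2-LIT, crux h413 = `stmt-HodgeConjecture-24833`, route of record `HCCMUnconditional`; cell `hodgecm-mathlib`, R90-TF programme, section S8 «ContSpec-n½», socket (E)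
`sock_S8_res_exhaustion_le_closure` (B ED. 6 :254–:270, statement frozen; CLOSURE TARGET row T2.1).  THEOREMS ONLY (no `def`, no `instance`, no `notation`, no named-fact hypothesis,
no `sorry`; default heartbeats); lane `--supports stmt-HodgeConjecture-24833 --as helper` (count-neutral).  CLOSES NO SOCKET: (E) stays `sorry` in B until the four letters below
are paid; this file only FREEZES them — after it (E) reads «★ modulo (HEAD₃) [K2E1-p11], (O₃) = R6₃ [E1 ∕ ★ C4 modulo its Haar data + `hχb`], (N₃) [E1 Plancherel estate], (L₃)-data
+ `heTop` [F6 chain] + `heMid` [MID road]».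

THE MATHEMATICS ([MoeglinWaldspurger1995, I.2.18, II.2.1, II.2.4, V.3.13, VI.2]; [Rogawski1990, §13.9 p. 229 (i)–(ii)]; [Langlands1976, §7]).  Langlands' `L²` theory for the Borel
subgroup of the quasi-split `U(2,1)`: `L²_res = L²_disc ⊓ (L²_cusp)ᗮ` is spanned by the residues of the Eisenstein series `E(φ, z)`, `φ ∈ V(χ₁, χ₂; K′, ω)`, at the poles `z = 2`
(case (i): the character lines `ℂ·[ψ̄∘det]`) and `z = 3∕2` (case (ii): the blocks `⊗πⁿ(ξ_v)`, here the middle blocks of record ★ `resGMidBlock L μ ξ μω`).  ★ F1_qs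
`residualG_le_topologicalClosure_of_letters_quasiSplit` (p862541) is the HILBERT-SPACE SKELETON of this argument with six abstract binders `hD hHead hEblk hO hN hL` over an index `ι`,
isotypic pieces `Iso i`, blocks `Blk i b`, atoms `At i b`, lines `Ln i b`.  THIS FILE instantiates it at the K-TYPE INDEX OF RECORD (S8-R82∕R87∕R94):
`ι₃ = {Kf open, Kf ≤ K₀ := ι_f⁻¹(K_∞·GL₃(𝒪̂))} × {τ : closed irreducible K_∞-subrepresentation of L²}`, `Iso i = Fix(ι_f Kf) ⊓ N_τ` (★ (D₃)), block index = ONE Borel-datum family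
`b ↦ (χ₁ b, χ₂ b)` WITHOUT associate pairs (`hT`; so (O₃)'s model clause `hOD` is vacuous), `Blk i b = resGBlockK L μ N_τ Kf (χ₁ b) (χ₂ b)` (★ p862819),
**`At i b := span (range eTop_{Kf,b}) ⊔ span (range eMid_{Kf,b})`** — the span of the LISTED top-pole and middle-pole residue classes of the block (no block-model map is needed: the
atoms ARE the residues), `Ln i b := Sc_{Kf,b} ⊓ (At i b)ᗮ` with `Sc_{Kf,b} = resGBlock L μ (ι_f Kf) 1 (χ₁ b) (χ₂ b)` (★ G-DEFS), `Bn ξ := resGMidBlock L μ ξ μω`.  Then: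
* `hD` — ★ (D₃) `residualG_isotypic_density_kType_three_maximalLevel_assoc` (letter-free);
* `hHead i` — ★ glue `hHead_kType_of_level_three` over the VISIBLE (HEAD₃) level letter `hHead_level`, its stability binder `hstab` DISCHARGED here (§1: ★ `rightRegular_apply_mem_resGBlock`
  at `k := ι_∞(k_∞)`, height invariance ★ `borelHeight_mul_of_adelicVal_mem` ∘ ★ `adelicVal_archToAdelic_inclusion_mem_standardMaximalCompactGL`, commutation ★
  `commute_archToAdelic_finAdelicToAdelic`, `χ₂ b` automorphic);
* `hEblk` — letter-free: `Blk ≤ Sc ≤ cl (At ⊔ (Sc ⊓ Atᗮ))` (★ `le_topologicalClosure_sup_inf_orthogonal`, (B) `eTop, eMid ∈ Sc`);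
* `hO i` — from the VISIBLE (O₃) letter `hBO` = R6₃ BLOCK ORTHOGONALITY in ★ C4 `hBO_of_rayTrivial_cm_three`'s conclusion bytes at `(K′, ω) := (ι_f Kf, 1)` + the transversal clause `hT`
  (§0 `isOrtho_iSup_sup_inf_orthogonal_of_isOrtho`: in-block by definition of `Ln`, cross-block `At_b ≤ Sc_b ⟂ Sc_{b′} ≥ Ln_{b′}`);
* `hN i b` — the VISIBLE (N₃) letter `hNblk` «an irreducible of `L²_res` has no mass in `Sc ⊓ (T ⊔ M)ᗮ`» (conclusion-shaped, Q1 «=» S8-R149 (2)), cut from `Fix(ι_f Kf)` to `Iso i` by monotonicity;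
  §2 `hNblk_of_lineModel` is its BY-NAME JUNCTION with ★ (N_blk,₃) `resG_isotypic_le_orthogonal_lines` (`R90S8ResGIsotypicVectorsAreResiduesU3` :155) at ANY block-model map `U` whose atoms lie in `T ⊔ M` (e.g. the ★ brick
  `exists_threeSlotModel_resGBlock_split`'s `U`, conjunct `hatom` = COMPLETENESS (C)) — so (C), (⊥), (R) and `U_Λ` live with the (N₃) payer, not in this assembly;
* `hL i b` — from the VISIBLE (L₃) data: `heTop` (each top class is a.e. `r·Θ((out x)⁻¹)`, ★ F6 `mem_iSup_lineSubrep_cmDetChar_three_of_ae_eq`) and `heMid` (each middle class lies in some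
  middle atom, ★ `resGMidAtom_le_resGMidBlock`): `span eTop ⊔ span eMid ≤ (⨆_ψ ℂ·[ψ̄∘det]) ⊔ ⨆_ξ resGMidBlock ξ μω`.
* §0 generic Hilbert-space lemmas; §1 `hstab` discharged; §2 the (N₃) junction; §3 **`res_exhaustion_le_closure_of_letters`** — THE HEAD: frame binders of (E) + the four letters curried
  over `(Kf, b)` (never Σ-packed) ⊢ (E)'s conclusion bytes VERBATIM (B-file payer line: `fun L _ _ _ μ _ 𝔓 _ μω _ _ P hP => res_exhaustion_le_closure_of_letters L μ 𝔓 μω χ₁ χ₂ hχ₂ hT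
  hHead_level hBO eTop eMid hTopSc hMidSc heTop heMid hNblk P hP` once the letters are ★).
HONEST LABEL: HC_CM is proved only modulo the 7 printed citations (2 remaining named inputs: hLiu418 = `stmt-HodgeConjecture-24832`, h413 = `stmt-HodgeConjecture-24833`) until
rung 0 closes; REL ≠ ★ ≠ BUILT; this file asserts no named fact, is conditional by construction on its four visible letters, and closes no socket; count-neutral.

## References
* [MoeglinWaldspurger1995] C. Mœglin, J.-L. Waldspurger, *Spectral Decomposition and Eisenstein Series* (1995), I.2.18, II.2.1, II.2.4, V.3.13, VI.2.
* [Rogawski1990] J. D. Rogawski, *Automorphic Representations of Unitary Groups in Three Variables* (1990), §13.9 p. 229 (i)–(ii), Thm. 13.3.6 p. 202.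
* [Langlands1976] R. P. Langlands, *On the Functional Equations Satisfied by Eisenstein Series*, LNM 544 (1976), §7.
* [BorelJacquet1979] A. Borel, H. Jacquet, *Automorphic forms and automorphic representations*, Corvallis I (1979), §4.1, §4.6.
* [DeitmarEchterhoff2014] A. Deitmar, S. Echterhoff, *Principles of Harmonic Analysis* (2nd ed., 2014), Prop. 7.3.3.
-/

set_option autoImplicit false
set_option linter.dupNamespace false  -- the mandated namespace `…HodgeConjecture.HodgeConjecture.R90.S8` (LEAD #1 L1) repeats the summit's segment

noncomputable section

open MeasureTheory Measure Set Filter Topology NumberField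
open Literature.NumberTheory Literature.NumberTheory.Automorphic Literature.NumberTheory.Automorphic.UnitaryGroup Literature.NumberTheory.GaloisRepresentations AdelicGroupData
open Literature.NumberTheory.Automorphic.Arthur2013.Leaves.TECR Literature.NumberTheory.Rogawski1990
open Summit.HodgeConjecture.HodgeConjecture.Cruxes.H413.K2E1CuspidalSpectrumUnitary (residualSubspace)
open Summit.HodgeConjecture.HodgeConjecture.Cruxes.H413.K2E1BorelEisensteinU
open Summit.HodgeConjecture.HodgeConjecture.Cruxes.H413.K2E1CharacterEisensteinU2Defs (reflectChar)
open Summit.HodgeConjecture.HodgeConjecture.Cruxes.H413.K2E1ChiEisensteinTopResidueCharLineU3 (mem_iSup_lineSubrep_cmDetChar_three_of_ae_eq)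
open Summit.HodgeConjecture.HodgeConjecture.Cruxes.H413.K2E1MaximalLevelHeckePureTensorBridgeCMTwo (adelicVal_archToAdelic_inclusion_mem_standardMaximalCompactGL)
open Summit.HodgeConjecture.HodgeConjecture.Cruxes.H413.K2E1BorelEisensteinGodementU (borelHeight_mul_of_adelicVal_mem)
open ContRepresentation
open scoped ENNReal NNReal InnerProductSpace

namespace Summit.HodgeConjecture.HodgeConjecture.R90.S8

/-! ## §0 Generic Hilbert-space lemmas: the `hO` and `hEblk` shapes for `At := A_b`, `Ln := Sc_b ⊓ A_bᗮ` -/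

section Generic

variable {H : Type*} [NormedAddCommGroup H] [InnerProductSpace ℂ H]

/-- **`hO` for atoms-as-residue-spans**: if `A_b ≤ Sc_b` and distinct blocks are orthogonal, then `(⨆_b A_b) ⟂ (⨆_b (Sc_b ⊓ A_bᗮ))` — in-block `A_b ⟂ A_bᗮ`, cross-block
`A_b ≤ Sc_b ⟂ Sc_{b′} ≥ Sc_{b′} ⊓ A_{b′}ᗮ`. [cite: MoeglinWaldspurger1995, II.2.1, VI.2] -/
theorem isOrtho_iSup_sup_inf_orthogonal_of_isOrtho {β : Type*} (Sc A : β → Submodule ℂ H) (hA : ∀ b, A b ≤ Sc b)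
    (hsep : ∀ b b' : β, b ≠ b' → Sc b ⟂ Sc b') :
    (⨆ b, A b) ⟂ (⨆ b, Sc b ⊓ (A b)ᗮ) := by
  refine Submodule.isOrtho_iSup_left.2 fun b => Submodule.isOrtho_iSup_right.2 fun b' => ?_
  by_cases h : b = b'
  · subst h
    exact (Submodule.isOrtho_orthogonal_right (A b)).mono_right inf_le_right
  · exact ((hsep b b' h).mono_left (hA b)).mono_right inf_le_left

/-- **The (N₃) currency change**: if the atoms of a block-model lie in `A` (`At ≤ A`), then `Sc ⊓ Aᗮ ≤ Sc ⊓ Atᗮ`, hence `(Sc ⊓ Atᗮ)ᗮ ≤ (Sc ⊓ Aᗮ)ᗮ`. [folklore] -/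
theorem orthogonal_inf_orthogonal_mono (Sc At A : Submodule ℂ H) (h : At ≤ A) : (Sc ⊓ Atᗮ)ᗮ ≤ (Sc ⊓ Aᗮ)ᗮ :=
  Submodule.orthogonal_le (inf_le_inf_left Sc (Submodule.orthogonal_le h))

end Generic

/-! ## §1 `hstab` DISCHARGED: the finite-level Borel blocks `Sc(ι_f Kf, 1; χ₁, χ₂)` are `K_∞`-stable (`χ₂` automorphic) -/

section CMThree

variable (L : Type) [Field L] [NumberField L] [IsCMField L]
  (μ : Measure (quasiSplit (↥(maximalRealSubfield L)) L (IsCMField.complexConj L) 3).automorphicQuotient) [(quasiSplit (↥(maximalRealSubfield L)) L (IsCMField.complexConj L) 3).IsAutomorphicMeasure μ]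

/-- **THE `K_∞`-STABILITY OF THE FINITE-LEVEL BLOCKS** (the `hstab` binder of ★ `hHead_kType_of_level_three`, DISCHARGED): for `k_∞ ∈ K_∞ = U(J₃)(L⁺⊗ℝ) ∩ U(1⊗1)`, `ρ(k_∞) = R(ι_∞ k_∞)`
maps `resGBlock L μ (ι_f Kf) 1 χ₁ χ₂` into itself — ★ `rightRegular_apply_mem_resGBlock` with `hHk` := `ι_∞(K_∞) ⊆ K_∞·GL₃(𝒪̂)` preserves the Borel height (★
`adelicVal_archToAdelic_inclusion_mem_standardMaximalCompactGL`, ★ `borelHeight_mul_of_adelicVal_mem`) and `hcomm` := the archimedean and finite factors commute (★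
`commute_archToAdelic_finAdelicToAdelic`).  The Borel σ-algebra on `U(J₃)(𝔸)` is supplied locally. [cite: MoeglinWaldspurger1995, II.1.1, II.2.4] [cite: BorelJacquet1979, §4.1, §4.6] -/
theorem restrict_archInfUnitaryOne_apply_mem_resGBlock
    (Kf : Subgroup ↥(finAdelic (↥(maximalRealSubfield L)) L (IsCMField.complexConj L) 3 ((StdForm.antidiagonal 3).over L))) (χ₁ : HeckeCharacter L) {χ₂ : ↥(TorusDict.torus (IsCMField.complexConj L)) →ₜ* ℂˣ} (hχ₂ : TorusDict.IsAutomorphic (IsCMField.complexConj L) χ₂)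
    (k : ↥(UnitaryGroup.arch (↥(maximalRealSubfield L)) L (IsCMField.complexConj L) 3 ((StdForm.antidiagonal 3).over L) ⊓ unitaryGroupOfForm (conjMixed (↥(maximalRealSubfield L)) L (IsCMField.complexConj L)) 1)) {v : (quasiSplit (↥(maximalRealSubfield L)) L (IsCMField.complexConj L) 3).L2 μ} (hv : v ∈ resGBlock L μ (Kf.map (finAdelicToAdelic (↥(maximalRealSubfield L)) L (IsCMField.complexConj L) 3 ((StdForm.antidiagonal 3).over L))) 1 χ₁ χ₂) :
    ((((quasiSplit (↥(maximalRealSubfield L)) L (IsCMField.complexConj L) 3).rightRegular μ).restrict ((archToAdelic (↥(maximalRealSubfield L)) L (IsCMField.complexConj L) 3 ((StdForm.antidiagonal 3).over L)).comp (Subgroup.inclusion (inf_le_left : (UnitaryGroup.arch (↥(maximalRealSubfield L)) L (IsCMField.complexConj L) 3 ((StdForm.antidiagonal 3).over L) ⊓ unitaryGroupOfForm (conjMixed (↥(maximalRealSubfield L)) L (IsCMField.complexConj L)) 1) ≤ UnitaryGroup.arch (↥(maximalRealSubfield L)) L (IsCMField.complexConj L) 3 ((StdForm.antidiagonal 3).over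 L)))))) k v ∈ resGBlock L μ (Kf.map (finAdelicToAdelic (↥(maximalRealSubfield L)) L (IsCMField.complexConj L) 3 ((StdForm.antidiagonal 3).over L))) 1 χ₁ χ₂ := by
  letI : MeasurableSpace (quasiSplit (↥(maximalRealSubfield L)) L (IsCMField.complexConj L) 3).Adelic := borel _
  haveI : BorelSpace (quasiSplit (↥(maximalRealSubfield L)) L (IsCMField.complexConj L) 3).Adelic := ⟨rfl⟩
  rw [ContRepresentation.restrict_apply, MonoidHom.coe_comp, Function.comp_apply]
  exact rightRegular_apply_mem_resGBlock L μ (Kf.map (finAdelicToAdelic (↥(maximalRealSubfield L)) L (IsCMField.complexConj L) 3 ((StdForm.antidiagonal 3).over L))) 1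
    (fun g => borelHeight_mul_of_adelicVal_mem (adelicVal_archToAdelic_inclusion_mem_standardMaximalCompactGL k) g)
    (fun k' hk' => by
      obtain ⟨u, -, rfl⟩ := Subgroup.mem_map.1 hk'
      exact (commute_archToAdelic_finAdelicToAdelic (a := (Subgroup.inclusion (inf_le_left : (UnitaryGroup.arch (↥(maximalRealSubfield L)) L (IsCMField.complexConj L) 3 ((StdForm.antidiagonal 3).over L) ⊓ unitaryGroupOfForm (conjMixed (↥(maximalRealSubfield L)) L (IsCMField.complexConj L)) 1) ≤ UnitaryGroup.arch (↥(maximalRealSubfield L)) L (IsCMField.complexConj L) 3 ((StdForm.antidiagonal 3).over L))) k) (b := u)).eq.symm) χ₁ hχ₂ hv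

/-! ## §2 The (N₃) JUNCTION: the visible letter `hNblk` from the ★ by-name (N_blk,₃) conclusion at any block-model map whose atoms are the listed residues -/

variable {A M Λ : Type*} [AddCommGroup A] [Module ℂ A] [AddCommGroup M] [Module ℂ M] [AddCommGroup Λ] [Module ℂ Λ]

/-- **(N₃) BY NAME ⟹ (N₃) OF RECORD.**  Let `U : L² →ₗ (A × M) × Λ` be ANY block-model map at the block `Sc = resGBlock L μ (ι_f Kf) 1 χ₁ χ₂` whose atoms lie in the residue span,
`resGAtom L μ U (ι_f Kf) 1 χ₁ χ₂ ≤ T ⊔ M` (`hatom`; for the ★ brick `exists_threeSlotModel_resGBlock_split` this is its COMPLETENESS conjunct (C): a block vector with zero line coordinate is a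
combination of the listed residues).  Then the conclusion of ★ (N_blk,₃) `resG_isotypic_le_orthogonal_lines` at `(K′, ω) := (ι_f Kf, 1)` and this `U` — «`W ⊓ Fix_{K′}(1) ≤ (resGLine U)ᗮ` for
every irreducible residual `W`» — gives the visible (N₃) letter of §3: `W ⊓ Fix(ι_f Kf) ≤ (Sc ⊓ (T ⊔ M)ᗮ)ᗮ` (`Fix(ι_f Kf) ≤ Fix_{ι_f(Kf)}(1)` as `ι_f(Kf)` is the image; ★ `resGLine U = Sc ⊓ (resGAtom U)ᗮ`
and §0 `orthogonal_inf_orthogonal_mono`).  This is how the E1 Plancherel estate pays (N₃): ★ :155 at the brick's `U` + the brick's `hatom`. [cite: MoeglinWaldspurger1995, IV.3.12, V.3.13, VI.2] [cite: Rogawski1990, §13.9 p. 229] -/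
theorem hNblk_of_lineModel (𝔓 : (quasiSplit (↥(maximalRealSubfield L)) L (IsCMField.complexConj L) 3).ParabolicUnipotentData)
    (Kf : Subgroup ↥(finAdelic (↥(maximalRealSubfield L)) L (IsCMField.complexConj L) 3 ((StdForm.antidiagonal 3).over L))) (χ₁ : HeckeCharacter L) (χ₂ : ↥(TorusDict.torus (IsCMField.complexConj L)) →ₜ* ℂˣ)
    (U : (quasiSplit (↥(maximalRealSubfield L)) L (IsCMField.complexConj L) 3).L2 μ →ₗ[ℂ] (A × M) × Λ) (T : Submodule ℂ ((quasiSplit (↥(maximalRealSubfield L)) L (IsCMField.complexConj L) 3).L2 μ))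
    (hatom : resGAtom L μ U (Kf.map (finAdelicToAdelic (↥(maximalRealSubfield L)) L (IsCMField.complexConj L) 3 ((StdForm.antidiagonal 3).over L))) 1 χ₁ χ₂ ≤ T)
    (hN : ∀ W : ClosedSubrep ((quasiSplit (↥(maximalRealSubfield L)) L (IsCMField.complexConj L) 3).rightRegular μ), W.toContRep.IsTopIrreducible → W ≤ residualSubspace (quasiSplit (↥(maximalRealSubfield L)) L (IsCMField.complexConj L) 3) μ 𝔓 →
      W.toSubmodule ⊓ (⨅ k : ↥(Kf.map (finAdelicToAdelic (↥(maximalRealSubfield L)) L (IsCMField.complexConj L) 3 ((StdForm.antidiagonal 3).over L))), Module.End.eigenspace ((((quasiSplit (↥(maximalRealSubfield L)) L (IsCMField.complexConj L) 3).rightRegular μ) ((Kf.map (finAdelicToAdelic (↥(maximalRealSubfield L)) L (IsCMField.complexConj L) 3 ((StdForm.antidiagonal 3).over L))).subtype k) : (quasiSplit (↥(maximalRealSubfield L)) L (IsCMField.complexConj L) 3).L2 μ →L[ℂ] (quasiSplit (↥(maximalRealSubfield L)) L (IsCMField.complexConj L) 3).L2 μ) :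
        (quasiSplit (↥(maximalRealSubfield L)) L (IsCMField.complexConj L) 3).L2 μ →ₗ[ℂ] (quasiSplit (↥(maximalRealSubfield L)) L (IsCMField.complexConj L) 3).L2 μ) ((1 : ↥(Kf.map (finAdelicToAdelic (↥(maximalRealSubfield L)) L (IsCMField.complexConj L) 3 ((StdForm.antidiagonal 3).over L))) →* ℂ) k)) ≤ (resGLine L μ U (Kf.map (finAdelicToAdelic (↥(maximalRealSubfield L)) L (IsCMField.complexConj L) 3 ((StdForm.antidiagonal 3).over L))) 1 χ₁ χ₂)ᗮ) :
    ∀ W : ClosedSubrep ((quasiSplit (↥(maximalRealSubfield L)) L (IsCMField.complexConj L) 3).rightRegular μ), W.toContRep.IsTopIrreducible → W ≤ residualSubspace (quasiSplit (↥(maximalRealSubfield L)) L (IsCMField.complexConj L) 3) μ 𝔓 →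
      W.toSubmodule ⊓ (⨅ u : ↥(Kf), Module.End.eigenspace ((((quasiSplit (↥(maximalRealSubfield L)) L (IsCMField.complexConj L) 3).rightRegular μ) (finAdelicToAdelic (↥(maximalRealSubfield L)) L (IsCMField.complexConj L) 3 ((StdForm.antidiagonal 3).over L) (u : ↥(finAdelic (↥(maximalRealSubfield L)) L (IsCMField.complexConj L) 3 ((StdForm.antidiagonal 3).over L)))) :
        (quasiSplit (↥(maximalRealSubfield L)) L (IsCMField.complexConj L) 3).L2 μ →L[ℂ] (quasiSplit (↥(maximalRealSubfield L)) L (IsCMField.complexConj L) 3).L2 μ) : (quasiSplit (↥(maximalRealSubfield L)) L (IsCMField.complexConj L) 3).L2 μ →ₗ[ℂ] (quasiSplit (↥(maximalRealSubfield L)) L (IsCMField.complexConj L) 3).L2 μ) 1) ≤ (resGBlock L μ (Kf.map (finAdelicToAdelic (↥(maximalRealSubfield L)) L (IsCMField.complexConj L) 3 ((StdForm.antidiagonal 3).over L))) 1 χ₁ χ₂ ⊓ Tᗮ)ᗮ := by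
  intro W hW hres
  -- `Fix(ι_f Kf) ≤ Fix_{ι_f(Kf)}(1)`: every `k ∈ ι_f(Kf)` is `ι_f u`, `u ∈ Kf`, and `1 k = 1`
  have hFix : (⨅ u : ↥(Kf), Module.End.eigenspace ((((quasiSplit (↥(maximalRealSubfield L)) L (IsCMField.complexConj L) 3).rightRegular μ) (finAdelicToAdelic (↥(maximalRealSubfield L)) L (IsCMField.complexConj L) 3 ((StdForm.antidiagonal 3).over L) (u : ↥(finAdelic (↥(maximalRealSubfield L)) L (IsCMField.complexConj L) 3 ((StdForm.antidiagonal 3).over L)))) :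
        (quasiSplit (↥(maximalRealSubfield L)) L (IsCMField.complexConj L) 3).L2 μ →L[ℂ] (quasiSplit (↥(maximalRealSubfield L)) L (IsCMField.complexConj L) 3).L2 μ) : (quasiSplit (↥(maximalRealSubfield L)) L (IsCMField.complexConj L) 3).L2 μ →ₗ[ℂ] (quasiSplit (↥(maximalRealSubfield L)) L (IsCMField.complexConj L) 3).L2 μ) 1) ≤ (⨅ k : ↥(Kf.map (finAdelicToAdelic (↥(maximalRealSubfield L)) L (IsCMField.complexConj L) 3 ((StdForm.antidiagonal 3).over L))), Module.End.eigenspace ((((quasiSplit (↥(maximalRealSubfield L)) L (IsCMField.complexConj L) 3).rightRegular μ) ((Kf.map (finAdelicToAdelic (↥(maximalRealSubfield L)) L (IsCMField.complexConj L) 3 ((StdForm.antidiagonal 3).over L))).subtype k) : (quasiSplit (↥(maximalRealSubfield L)) L (IsCMField.complexConj L) 3).L2 μ →L[ℂ] (quasiSplit (↥(maximalRealSubfield L)) L (IsCMField.complexConj L) 3).L2 μ) :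
        (quasiSplit (↥(maximalRealSubfield L)) L (IsCMField.complexConj L) 3).L2 μ →ₗ[ℂ] (quasiSplit (↥(maximalRealSubfield L)) L (IsCMField.complexConj L) 3).L2 μ) ((1 : ↥(Kf.map (finAdelicToAdelic (↥(maximalRealSubfield L)) L (IsCMField.complexConj L) 3 ((StdForm.antidiagonal 3).over L))) →* ℂ) k)) := by
    refine le_iInf fun k => ?_
    obtain ⟨u, hu, hk⟩ := Subgroup.mem_map.1 k.2
    have h1 : ((Kf.map (finAdelicToAdelic (↥(maximalRealSubfield L)) L (IsCMField.complexConj L) 3 ((StdForm.antidiagonal 3).over L))).subtype k : (quasiSplit (↥(maximalRealSubfield L)) L (IsCMField.complexConj L) 3).Adelic) = finAdelicToAdelic (↥(maximalRealSubfield L)) L (IsCMField.complexConj L) 3 ((StdForm.antidiagonal 3).over L) u := hk.symm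
    rw [h1, MonoidHom.one_apply]
    exact iInf_le (fun u : ↥(Kf) => Module.End.eigenspace ((((quasiSplit (↥(maximalRealSubfield L)) L (IsCMField.complexConj L) 3).rightRegular μ) (finAdelicToAdelic (↥(maximalRealSubfield L)) L (IsCMField.complexConj L) 3 ((StdForm.antidiagonal 3).over L) (u : ↥(finAdelic (↥(maximalRealSubfield L)) L (IsCMField.complexConj L) 3 ((StdForm.antidiagonal 3).over L)))) :
        (quasiSplit (↥(maximalRealSubfield L)) L (IsCMField.complexConj L) 3).L2 μ →L[ℂ] (quasiSplit (↥(maximalRealSubfield L)) L (IsCMField.complexConj L) 3).L2 μ) : (quasiSplit (↥(maximalRealSubfield L)) L (IsCMField.complexConj L) 3).L2 μ →ₗ[ℂ] (quasiSplit (↥(maximalRealSubfield L)) L (IsCMField.complexConj L) 3).L2 μ) 1) (⟨u, hu⟩ : ↥(Kf))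
  exact (inf_le_inf_left _ hFix).trans ((hN W hW hres).trans
    (orthogonal_inf_orthogonal_mono _ _ _ hatom))

/-! ## §3 THE HEAD — (E) of letters -/

/-- **(E) OF LETTERS — EXHAUSTION OF `L²_res(U_{L∕L⁺}(3))` BY THE CHARACTER LINES AND THE MIDDLE BLOCKS, modulo (HEAD₃) (O₃) (N₃) (L₃).**  Frame: Mok's `U(J₃) = quasiSplit L⁺ L c 3`, an
automorphic `μ`, any family of unipotent radicals `𝔓`, the middle-block twist `μω`, ONE Borel-datum family `b ↦ (χ₁ b, χ₂ b)` with `χ₂ b` automorphic (`hχ₂`) and no two members associate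
(`hT`: a transversal of `(χ₁, χ₂) ∼ (χ₁ʷ, χ₂)`).  VISIBLE LETTERS, curried over the finite level `Kf` (open, `≤ K₀ = ι_f⁻¹(K_∞·GL₃(𝒪̂))`) and the block `b`:
* (HEAD₃) `hHead_level` — LEVEL EXHAUSTION `(L²_cusp(𝔓))ᗮ ⊓ Fix(ι_f Kf) ≤ cl ⨆_b resGBlock L μ (ι_f Kf) 1 (χ₁ b) (χ₂ b)` [MW II.2.4] (owner K2E1-p11: ★ `cuspidal_orthogonal_inf_fixFin_le_topologicalClosure_span_nice_three` + the generator core);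
* (O₃) `hBO` — R6₃: NON-ASSOCIATE Borel data have ORTHOGONAL BLOCKS at level `(ι_f Kf, 1)` [MW II.2.1], the conclusion bytes of ★ C4 `hBO_of_rayTrivial_cm_three` (owner E1: ★ C4 modulo its structural Haar data and `hχb`);
* (L₃) DATA `eTop eMid` — the top-pole and middle-pole residue classes of each block, IN the block (`hTopSc hMidSc`), with `heTop` (each top class is a.e. `x ↦ r·Θ((out x)⁻¹)`, an automorphic
  character: ★ F6's currency, owner the F6 chain) and `heMid` (each middle class lies in a middle atom `resGMidAtom L μ ξ μω K″ ω″`, owner the MID road) [Rogawski1990 §13.9 (i)–(ii)];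
* (N₃) `hNblk` — NO LINE MASS: an irreducible `W ≤ L²_res(𝔓)` has `W ⊓ Fix(ι_f Kf) ⟂ Sc_{Kf,b} ⊓ (span eTop ⊔ span eMid)ᗮ` [MW IV.3.12, V.3.13, VI.2] (owner the E1 Plancherel estate, via §2 + ★ (N_blk,₃)).
CONCLUSION = (E)'s bytes: every irreducible `P ≤ L²_res(𝔓)` lies in `closure ((⨆_ψ ℂ·[ψ̄∘det]) ⊔ ⨆_ξ resGMidBlock L μ ξ μω)`.  PROOF: ONE `exact` of ★ F1_qs `residualG_le_topologicalClosure_of_letters_quasiSplit`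
at `ι₃`, `Iso i = Fix(ι_f Kf) ⊓ N_τ`, `Blk i b = resGBlockK L μ N_τ Kf (χ₁ b) (χ₂ b)`, `At i b = span eTop ⊔ span eMid`, `Ln i b = Sc ⊓ Atᗮ`, `Bn ξ = resGMidBlock L μ ξ μω`, with `hD` ★ (D₃), `hHead` ★ glue
+ §1, `hEblk` ★ `le_topologicalClosure_sup_inf_orthogonal`, `hO` §0, `hN` = `hNblk` cut to `Iso i`, `hL` from `heTop`∕`heMid` (★ F6, ★ `resGMidAtom_le_resGMidBlock`).
[cite: MoeglinWaldspurger1995, I.2.18, II.2.1, II.2.4, V.3.13, VI.2] [cite: Rogawski1990, §13.9 p. 229 (i)–(ii)] [cite: Langlands1976, §7] -/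
theorem res_exhaustion_le_closure_of_letters (𝔓 : (quasiSplit (↥(maximalRealSubfield L)) L (IsCMField.complexConj L) 3).ParabolicUnipotentData) (μω : HeckeCharacter L)
    {β : Type*} (χ₁ : β → HeckeCharacter L) (χ₂ : β → (↥(TorusDict.torus (IsCMField.complexConj L)) →ₜ* ℂˣ)) (hχ₂ : ∀ b, TorusDict.IsAutomorphic (IsCMField.complexConj L) (χ₂ b))
    (hT : ∀ b b' : β, b ≠ b' → ¬ ((χ₁ b' = χ₁ b ∧ χ₂ b' = χ₂ b) ∨ (χ₁ b' = reflectChar (IsCMField.complexConj L) (χ₁ b) ∧ χ₂ b' = χ₂ b)))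
    (hHead_level : ∀ Kf : {Kf : Subgroup ↥(finAdelic (↥(maximalRealSubfield L)) L (IsCMField.complexConj L) 3 ((StdForm.antidiagonal 3).over L)) // IsOpen ((Kf : Subgroup ↥(finAdelic (↥(maximalRealSubfield L)) L (IsCMField.complexConj L) 3 ((StdForm.antidiagonal 3).over L))) : Set ↥(finAdelic (↥(maximalRealSubfield L)) L (IsCMField.complexConj L) 3 ((StdForm.antidiagonal 3).over L))) ∧ Kf ≤ ((((standardMaximalCompactGL 3 L).comap (adelicVal (↥(maximalRealSubfield L)) L (IsCMField.complexConj L) 3 ((StdForm.antidiagonal 3).over L)) : Subgroup (quasiSplit (↥(maximalRealSubfield L)) L (IsCMField.complexConj L) 3).Adelic)).comap (finAdelicToAdelic (↥(maximalRealSubfield L)) L (IsCMField.complexConj L) 3 ((StdForm.antidiagonal 3).over L)) : Subgroup ↥(finAdelic (↥(maximalRealSubfield L)) L (IsCMField.complexConj L) 3 ((StdForm.antidiagonal 3).over L)))},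
      ((quasiSplit (↥(maximalRealSubfield L)) L (IsCMField.complexConj L) 3).cuspidalSubspace μ 𝔓).toSubmoduleᗮ ⊓ (⨅ u : ↥(Kf.1), Module.End.eigenspace ((((quasiSplit (↥(maximalRealSubfield L)) L (IsCMField.complexConj L) 3).rightRegular μ) (finAdelicToAdelic (↥(maximalRealSubfield L)) L (IsCMField.complexConj L) 3 ((StdForm.antidiagonal 3).over L) (u : ↥(finAdelic (↥(maximalRealSubfield L)) L (IsCMField.complexConj L) 3 ((StdForm.antidiagonal 3).over L)))) :
        (quasiSplit (↥(maximalRealSubfield L)) L (IsCMField.complexConj L) 3).L2 μ →L[ℂ] (quasiSplit (↥(maximalRealSubfield L)) L (IsCMField.complexConj L) 3).L2 μ) : (quasiSplit (↥(maximalRealSubfield L)) L (IsCMField.complexConj L) 3).L2 μ →ₗ[ℂ] (quasiSplit (↥(maximalRealSubfield L)) L (IsCMField.complexConj L) 3).L2 μ) 1) ≤ (⨆ b, resGBlock L μ (Kf.1.map (finAdelicToAdelic (↥(maximalRealSubfield L)) L (IsCMField.complexConj L) 3 ((StdForm.antidiagonal 3).over L))) 1 (χ₁ b) (χ₂ b)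).topologicalClosure)
    (hBO : ∀ (Kf : {Kf : Subgroup ↥(finAdelic (↥(maximalRealSubfield L)) L (IsCMField.complexConj L) 3 ((StdForm.antidiagonal 3).over L)) // IsOpen ((Kf : Subgroup ↥(finAdelic (↥(maximalRealSubfield L)) L (IsCMField.complexConj L) 3 ((StdForm.antidiagonal 3).over L))) : Set ↥(finAdelic (↥(maximalRealSubfield L)) L (IsCMField.complexConj L) 3 ((StdForm.antidiagonal 3).over L))) ∧ Kf ≤ ((((standardMaximalCompactGL 3 L).comap (adelicVal (↥(maximalRealSubfield L)) L (IsCMField.complexConj L) 3 ((StdForm.antidiagonal 3).over L)) : Subgroup (quasiSplit (↥(maximalRealSubfield L)) L (IsCMField.complexConj L) 3).Adelic)).comap (finAdelicToAdelic (↥(maximalRealSubfield L)) L (IsCMField.complexConj L) 3 ((StdForm.antidiagonal 3).over L)) : Subgroup ↥(finAdelic (↥(maximalRealSubfield L)) L (IsCMField.complexConj L) 3 ((StdForm.antidiagonal 3).over L)))}) (b b' : β), b ≠ b' → ¬ ((χ₁ b' = χ₁ b ∧ χ₂ b' = χ₂ b) ∨ (χ₁ b' = reflectChar (IsCMField.complexConj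 L) (χ₁ b) ∧ χ₂ b' = χ₂ b)) →
      resGBlock L μ (Kf.1.map (finAdelicToAdelic (↥(maximalRealSubfield L)) L (IsCMField.complexConj L) 3 ((StdForm.antidiagonal 3).over L))) 1 (χ₁ b) (χ₂ b) ⟂ resGBlock L μ (Kf.1.map (finAdelicToAdelic (↥(maximalRealSubfield L)) L (IsCMField.complexConj L) 3 ((StdForm.antidiagonal 3).over L))) 1 (χ₁ b') (χ₂ b'))
    {ιt ιm : {Kf : Subgroup ↥(finAdelic (↥(maximalRealSubfield L)) L (IsCMField.complexConj L) 3 ((StdForm.antidiagonal 3).over L)) // IsOpen ((Kf : Subgroup ↥(finAdelic (↥(maximalRealSubfield L)) L (IsCMField.complexConj L) 3 ((StdForm.antidiagonal 3).over L))) : Set ↥(finAdelic (↥(maximalRealSubfield L)) L (IsCMField.complexConj L) 3 ((StdForm.antidiagonal 3).over L))) ∧ Kf ≤ ((((standardMaximalCompactGL 3 L).comap (adelicVal (↥(maximalRealSubfield L)) L (IsCMField.complexConj L) 3 ((StdForm.antidiagonal 3).over L)) : Subgroup (quasiSplit (↥(maximalRealSubfield L)) L (IsCMField.complexConj L) 3).Adelic)).comap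 (finAdelicToAdelic (↥(maximalRealSubfield L)) L (IsCMField.complexConj L) 3 ((StdForm.antidiagonal 3).over L)) : Subgroup ↥(finAdelic (↥(maximalRealSubfield L)) L (IsCMField.complexConj L) 3 ((StdForm.antidiagonal 3).over L)))} → β → Type*} (eTop : ∀ (Kf : {Kf : Subgroup ↥(finAdelic (↥(maximalRealSubfield L)) L (IsCMField.complexConj L) 3 ((StdForm.antidiagonal 3).over L)) // IsOpen ((Kf : Subgroup ↥(finAdelic (↥(maximalRealSubfield L)) L (IsCMField.complexConj L) 3 ((StdForm.antidiagonal 3).over L))) : Set ↥(finAdelic (↥(maximalRealSubfield L)) L (IsCMField.complexConj L) 3 ((StdForm.antidiagonal 3).over L))) ∧ Kf ≤ ((((standardMaximalCompactGL 3 L).comap (adelicVal (↥(maximalRealSubfield L)) L (IsCMField.complexConj L) 3 ((StdForm.antidiagonal 3).over L)) : Subgroup (quasiSplit (↥(maximalRealSubfield L)) L (IsCMField.complexConj L) 3).Adelic)).comap (finAdelicToAdelic (↥(maximalRealSubfield L)) L (IsCMField.complexConj L) 3 ((StdForm.antidiagonal 3).over L)) : Subgroup ↥(finAdelic (↥(maximalRealSubfield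 L)) L (IsCMField.complexConj L) 3 ((StdForm.antidiagonal 3).over L)))}) (b : β), ιt Kf b → (quasiSplit (↥(maximalRealSubfield L)) L (IsCMField.complexConj L) 3).L2 μ) (eMid : ∀ (Kf : {Kf : Subgroup ↥(finAdelic (↥(maximalRealSubfield L)) L (IsCMField.complexConj L) 3 ((StdForm.antidiagonal 3).over L)) // IsOpen ((Kf : Subgroup ↥(finAdelic (↥(maximalRealSubfield L)) L (IsCMField.complexConj L) 3 ((StdForm.antidiagonal 3).over L))) : Set ↥(finAdelic (↥(maximalRealSubfield L)) L (IsCMField.complexConj L) 3 ((StdForm.antidiagonal 3).over L))) ∧ Kf ≤ ((((standardMaximalCompactGL 3 L).comap (adelicVal (↥(maximalRealSubfield L)) L (IsCMField.complexConj L) 3 ((StdForm.antidiagonal 3).over L)) : Subgroup (quasiSplit (↥(maximalRealSubfield L)) L (IsCMField.complexConj L) 3).Adelic)).comap (finAdelicToAdelic (↥(maximalRealSubfield L)) L (IsCMField.complexConj L) 3 ((StdForm.antidiagonal 3).over L)) : Subgroup ↥(finAdelic (↥(maximalRealSubfield L)) L (IsCMField.complexConj L) 3 ((StdForm.antidiagonal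 3).over L)))}) (b : β), ιm Kf b → (quasiSplit (↥(maximalRealSubfield L)) L (IsCMField.complexConj L) 3).L2 μ)
    (hTopSc : ∀ Kf b k, eTop Kf b k ∈ resGBlock L μ (Kf.1.map (finAdelicToAdelic (↥(maximalRealSubfield L)) L (IsCMField.complexConj L) 3 ((StdForm.antidiagonal 3).over L))) 1 (χ₁ b) (χ₂ b)) (hMidSc : ∀ Kf b k, eMid Kf b k ∈ resGBlock L μ (Kf.1.map (finAdelicToAdelic (↥(maximalRealSubfield L)) L (IsCMField.complexConj L) 3 ((StdForm.antidiagonal 3).over L))) 1 (χ₁ b) (χ₂ b))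
    (heTop : ∀ Kf b k, ∃ (Θ : (quasiSplit (↥(maximalRealSubfield L)) L (IsCMField.complexConj L) 3).AutomorphicCharacter) (r : ℂ), ((eTop Kf b k : (quasiSplit (↥(maximalRealSubfield L)) L (IsCMField.complexConj L) 3).L2 μ) : (quasiSplit (↥(maximalRealSubfield L)) L (IsCMField.complexConj L) 3).automorphicQuotient → ℂ) =ᵐ[μ]
        fun x => r * ((Θ (Quotient.out (x : (quasiSplit (↥(maximalRealSubfield L)) L (IsCMField.complexConj L) 3).Adelic ⧸ (quasiSplit (↥(maximalRealSubfield L)) L (IsCMField.complexConj L) 3).quotientSubgroup))⁻¹ : ℂˣ) : ℂ))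
    (heMid : ∀ Kf b k, ∃ (ξ : OneDimAutRepH L) (K'' : Subgroup (quasiSplit (↥(maximalRealSubfield L)) L (IsCMField.complexConj L) 3).Adelic) (ω'' : ↥K'' →* ℂ), eMid Kf b k ∈ resGMidAtom L μ ξ μω K'' ω'')
    (hNblk : ∀ (Kf : {Kf : Subgroup ↥(finAdelic (↥(maximalRealSubfield L)) L (IsCMField.complexConj L) 3 ((StdForm.antidiagonal 3).over L)) // IsOpen ((Kf : Subgroup ↥(finAdelic (↥(maximalRealSubfield L)) L (IsCMField.complexConj L) 3 ((StdForm.antidiagonal 3).over L))) : Set ↥(finAdelic (↥(maximalRealSubfield L)) L (IsCMField.complexConj L) 3 ((StdForm.antidiagonal 3).over L))) ∧ Kf ≤ ((((standardMaximalCompactGL 3 L).comap (adelicVal (↥(maximalRealSubfield L)) L (IsCMField.complexConj L) 3 ((StdForm.antidiagonal 3).over L)) : Subgroup (quasiSplit (↥(maximalRealSubfield L)) L (IsCMField.complexConj L) 3).Adelic)).comap (finAdelicToAdelic (↥(maximalRealSubfield L)) L (IsCMField.complexConj L) 3 ((StdForm.antidiagonal 3).over L)) : Subgroup ↥(finAdelic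 (↥(maximalRealSubfield L)) L (IsCMField.complexConj L) 3 ((StdForm.antidiagonal 3).over L)))}) (b : β) (W : ClosedSubrep ((quasiSplit (↥(maximalRealSubfield L)) L (IsCMField.complexConj L) 3).rightRegular μ)), W.toContRep.IsTopIrreducible → W ≤ residualSubspace (quasiSplit (↥(maximalRealSubfield L)) L (IsCMField.complexConj L) 3) μ 𝔓 →
      W.toSubmodule ⊓ (⨅ u : ↥(Kf.1), Module.End.eigenspace ((((quasiSplit (↥(maximalRealSubfield L)) L (IsCMField.complexConj L) 3).rightRegular μ) (finAdelicToAdelic (↥(maximalRealSubfield L)) L (IsCMField.complexConj L) 3 ((StdForm.antidiagonal 3).over L) (u : ↥(finAdelic (↥(maximalRealSubfield L)) L (IsCMField.complexConj L) 3 ((StdForm.antidiagonal 3).over L)))) :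
        (quasiSplit (↥(maximalRealSubfield L)) L (IsCMField.complexConj L) 3).L2 μ →L[ℂ] (quasiSplit (↥(maximalRealSubfield L)) L (IsCMField.complexConj L) 3).L2 μ) : (quasiSplit (↥(maximalRealSubfield L)) L (IsCMField.complexConj L) 3).L2 μ →ₗ[ℂ] (quasiSplit (↥(maximalRealSubfield L)) L (IsCMField.complexConj L) 3).L2 μ) 1) ≤
        (resGBlock L μ (Kf.1.map (finAdelicToAdelic (↥(maximalRealSubfield L)) L (IsCMField.complexConj L) 3 ((StdForm.antidiagonal 3).over L))) 1 (χ₁ b) (χ₂ b) ⊓ (Submodule.span ℂ (Set.range (eTop Kf b)) ⊔ Submodule.span ℂ (Set.range (eMid Kf b)))ᗮ)ᗮ)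
    (P : DiscreteAutomorphicRep (quasiSplit (↥(maximalRealSubfield L)) L (IsCMField.complexConj L) 3) μ) (hP : P.space ≤ residualSubspace (quasiSplit (↥(maximalRealSubfield L)) L (IsCMField.complexConj L) 3) μ 𝔓) :
    P.space.toSubmodule ≤ ((⨆ ψ : {ψ : ↥(TorusDict.torus (IsCMField.complexConj L)) →ₜ* ℂˣ // TorusDict.IsAutomorphic (IsCMField.complexConj L) ψ},
        (AdelicGroupData.AutomorphicCharacter.lineSubrep (𝒢 := (quasiSplit (↥(maximalRealSubfield L)) L (IsCMField.complexConj L) 3))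
          (cmDetChar L 3 ((StdForm.antidiagonal 3).over L) ψ.1 ψ.2 ((Matrix.isUnit_iff_isUnit_det _).mp (StdForm.isUnit_over (StdForm.antidiagonal 3) L)).ne_zero) μ).toSubmodule) ⊔ ⨆ ξ : OneDimAutRepH L, (resGMidBlock L μ ξ μω).toSubmodule).topologicalClosure := by
  -- the residue spans lie in their blocks ((B))
  have hAtSc : ∀ (Kf : {Kf : Subgroup ↥(finAdelic (↥(maximalRealSubfield L)) L (IsCMField.complexConj L) 3 ((StdForm.antidiagonal 3).over L)) // IsOpen ((Kf : Subgroup ↥(finAdelic (↥(maximalRealSubfield L)) L (IsCMField.complexConj L) 3 ((StdForm.antidiagonal 3).over L))) : Set ↥(finAdelic (↥(maximalRealSubfield L)) L (IsCMField.complexConj L) 3 ((StdForm.antidiagonal 3).over L))) ∧ Kf ≤ ((((standardMaximalCompactGL 3 L).comap (adelicVal (↥(maximalRealSubfield L)) L (IsCMField.complexConj L) 3 ((StdForm.antidiagonal 3).over L)) : Subgroup (quasiSplit (↥(maximalRealSubfield L)) L (IsCMField.complexConj L) 3).Adelic)).comap (finAdelicToAdelic (↥(maximalRealSubfield L)) L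 (IsCMField.complexConj L) 3 ((StdForm.antidiagonal 3).over L)) : Subgroup ↥(finAdelic (↥(maximalRealSubfield L)) L (IsCMField.complexConj L) 3 ((StdForm.antidiagonal 3).over L)))}) (b : β), Submodule.span ℂ (Set.range (eTop Kf b)) ⊔ Submodule.span ℂ (Set.range (eMid Kf b)) ≤ resGBlock L μ (Kf.1.map (finAdelicToAdelic (↥(maximalRealSubfield L)) L (IsCMField.complexConj L) 3 ((StdForm.antidiagonal 3).over L))) 1 (χ₁ b) (χ₂ b) :=
    fun Kf b => sup_le (Submodule.span_le.2 (Set.range_subset_iff.2 (hTopSc Kf b))) (Submodule.span_le.2 (Set.range_subset_iff.2 (hMidSc Kf b)))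
  exact residualG_le_topologicalClosure_of_letters_quasiSplit L μ 𝔓 P.space P.irreducible hP
    (fun i : {Kf : Subgroup ↥(finAdelic (↥(maximalRealSubfield L)) L (IsCMField.complexConj L) 3 ((StdForm.antidiagonal 3).over L)) // IsOpen ((Kf : Subgroup ↥(finAdelic (↥(maximalRealSubfield L)) L (IsCMField.complexConj L) 3 ((StdForm.antidiagonal 3).over L))) : Set ↥(finAdelic (↥(maximalRealSubfield L)) L (IsCMField.complexConj L) 3 ((StdForm.antidiagonal 3).over L))) ∧ Kf ≤ ((((standardMaximalCompactGL 3 L).comap (adelicVal (↥(maximalRealSubfield L)) L (IsCMField.complexConj L) 3 ((StdForm.antidiagonal 3).over L)) : Subgroup (quasiSplit (↥(maximalRealSubfield L)) L (IsCMField.complexConj L) 3).Adelic)).comap (finAdelicToAdelic (↥(maximalRealSubfield L)) L (IsCMField.complexConj L) 3 ((StdForm.antidiagonal 3).over L)) : Subgroup ↥(finAdelic (↥(maximalRealSubfield L)) L (IsCMField.complexConj L) 3 ((StdForm.antidiagonal 3).over L)))} × {U : ClosedSubrep (((quasiSplit (↥(maximalRealSubfield L)) L (IsCMField.complexConj L)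 3).rightRegular μ).restrict ((archToAdelic (↥(maximalRealSubfield L)) L (IsCMField.complexConj L) 3 ((StdForm.antidiagonal 3).over L)).comp (Subgroup.inclusion (inf_le_left : (UnitaryGroup.arch (↥(maximalRealSubfield L)) L (IsCMField.complexConj L) 3 ((StdForm.antidiagonal 3).over L) ⊓ unitaryGroupOfForm (conjMixed (↥(maximalRealSubfield L)) L (IsCMField.complexConj L)) 1) ≤ UnitaryGroup.arch (↥(maximalRealSubfield L)) L (IsCMField.complexConj L) 3 ((StdForm.antidiagonal 3).over L))))) // U.toContRep.IsTopIrreducible} => (⨅ u : ↥(i.1.1), Module.End.eigenspace ((((quasiSplit (↥(maximalRealSubfield L)) L (IsCMField.complexConj L) 3).rightRegular μ) (finAdelicToAdelic (↥(maximalRealSubfield L)) L (IsCMField.complexConj L) 3 ((StdForm.antidiagonal 3).over L) (u : ↥(finAdelic (↥(maximalRealSubfield L)) L (IsCMField.complexConj L) 3 ((StdForm.antidiagonal 3).over L)))) :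
        (quasiSplit (↥(maximalRealSubfield L)) L (IsCMField.complexConj L) 3).L2 μ →L[ℂ] (quasiSplit (↥(maximalRealSubfield L)) L (IsCMField.complexConj L) 3).L2 μ) : (quasiSplit (↥(maximalRealSubfield L)) L (IsCMField.complexConj L) 3).L2 μ →ₗ[ℂ] (quasiSplit (↥(maximalRealSubfield L)) L (IsCMField.complexConj L) 3).L2 μ) 1) ⊓ ((((quasiSplit (↥(maximalRealSubfield L)) L (IsCMField.complexConj L) 3).rightRegular μ).restrict ((archToAdelic (↥(maximalRealSubfield L)) L (IsCMField.complexConj L) 3 ((StdForm.antidiagonal 3).over L)).comp (Subgroup.inclusion (inf_le_left : (UnitaryGroup.arch (↥(maximalRealSubfield L)) L (IsCMField.complexConj L) 3 ((StdForm.antidiagonal 3).over L) ⊓ unitaryGroupOfForm (conjMixed (↥(maximalRealSubfield L)) L (IsCMField.complexConj L)) 1) ≤ UnitaryGroup.arch (↥(maximalRealSubfield L)) L (IsCMField.complexConj L) 3 ((StdForm.antidiagonal 3).over L))))).isotypicComponent i.2.1.toContRep).toSubmodule)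
    (fun i b => resGBlockK L μ ((((quasiSplit (↥(maximalRealSubfield L)) L (IsCMField.complexConj L) 3).rightRegular μ).restrict ((archToAdelic (↥(maximalRealSubfield L)) L (IsCMField.complexConj L) 3 ((StdForm.antidiagonal 3).over L)).comp (Subgroup.inclusion (inf_le_left : (UnitaryGroup.arch (↥(maximalRealSubfield L)) L (IsCMField.complexConj L) 3 ((StdForm.antidiagonal 3).over L) ⊓ unitaryGroupOfForm (conjMixed (↥(maximalRealSubfield L)) L (IsCMField.complexConj L)) 1) ≤ UnitaryGroup.arch (↥(maximalRealSubfield L)) L (IsCMField.complexConj L) 3 ((StdForm.antidiagonal 3).over L))))).isotypicComponent i.2.1.toContRep).toSubmodule i.1.1 (χ₁ b) (χ₂ b))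
    (fun i b => Submodule.span ℂ (Set.range (eTop i.1 b)) ⊔ Submodule.span ℂ (Set.range (eMid i.1 b)))
    (fun i b => resGBlock L μ (i.1.1.map (finAdelicToAdelic (↥(maximalRealSubfield L)) L (IsCMField.complexConj L) 3 ((StdForm.antidiagonal 3).over L))) 1 (χ₁ b) (χ₂ b) ⊓ (Submodule.span ℂ (Set.range (eTop i.1 b)) ⊔ Submodule.span ℂ (Set.range (eMid i.1 b)))ᗮ)
    (fun ξ : OneDimAutRepH L => resGMidBlock L μ ξ μω)
    (residualG_isotypic_density_kType_three_maximalLevel_assoc L μ P.space P.irreducible)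
    (fun i => hHead_kType_of_level_three L μ 𝔓 i.1.1 χ₁ χ₂
      (fun b k v hv => restrict_archInfUnitaryOne_apply_mem_resGBlock L μ i.1.1 (χ₁ b) (hχ₂ b) k hv) i.2.1 (hHead_level i.1))
    (fun i b => (resGBlockK_le_resGBlock L μ _ i.1.1 (χ₁ b) (χ₂ b)).trans
      (le_topologicalClosure_sup_inf_orthogonal _ (isClosed_resGBlock L μ _ 1 (χ₁ b) (χ₂ b)) _ (hAtSc i.1 b)))
    (fun i => isOrtho_iSup_sup_inf_orthogonal_of_isOrtho
      (fun b => resGBlock L μ (i.1.1.map (finAdelicToAdelic (↥(maximalRealSubfield L)) L (IsCMField.complexConj L) 3 ((StdForm.antidiagonal 3).over L))) 1 (χ₁ b) (χ₂ b))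
      (fun b => Submodule.span ℂ (Set.range (eTop i.1 b)) ⊔ Submodule.span ℂ (Set.range (eMid i.1 b))) (hAtSc i.1)
      (fun b b' hne => hBO i.1 b b' hne (hT b b' hne)))
    (fun i b W hW hres => (inf_le_inf_left _ inf_le_left).trans (hNblk i.1 b W hW hres))
    (fun i b => sup_le
      (Submodule.span_le.2 (Set.range_subset_iff.2 fun k => by
        obtain ⟨Θ, r, h⟩ := heTop i.1 b k
        exact Submodule.mem_sup_left (mem_iSup_lineSubrep_cmDetChar_three_of_ae_eq L μ Θ r h)))
      (Submodule.span_le.2 (Set.range_subset_iff.2 fun k => by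
        obtain ⟨ξ, K'', ω'', h⟩ := heMid i.1 b k
        exact Submodule.mem_sup_right (Submodule.mem_iSup_of_mem ξ (resGMidAtom_le_resGMidBlock L μ ξ μω K'' ω'' h)))))

end CMThree

end Summit.HodgeConjecture.HodgeConjecture.R90.S8

end
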